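/-
Copyright (c) 2026 the pub-hodgecm-mathlib formalisation cell (harness21).  Prover seat hodgecm-mathlib-K2E5-p16 (g6), Track B «K2-LIT»,
#184♮ = hLiu418 = `stmt-HodgeConjecture-24832`; organ S2-J, (J2⊗-arch) FILE 2b part 2 `K2LiuArchTensorPlaceSec` (LEAD F0P6-plan (g14) BATCH #20 (1),
K2Liu-p05 (g5) target 13:14:07Z): **`tensorEmb (archToAdelic (placeSec_𝔻 σ h)) = archToAdelic (placeSec_𝕎 σ (relabel eP eQ (toBig (h, 1))))`** — the place
section of `𝔻` at a real place `σ`, tensored with `1_{V′}`, IS the place section of `𝕎 = 𝔻 ⊗ V′` at Konno–Konno's junction element `toBig (h, 1)` read in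
the sign frame of `𝕎_σ`.  THEOREMS ONLY (no `def`, no `instance`, no notation, no `sorry`).
-/
import Summits.HodgeConjecture.HodgeConjecture.Theorems.K2LiuArchTensorEmbArchComponent   -- ★ FILE 2b-1 (this seat)
import Summits.HodgeConjecture.HodgeConjecture.Theorems.K2LiuArchTensorFrameChase         -- ★ FILE 2a (this seat)
import Summits.HodgeConjecture.HodgeConjecture.Theorems.K2LiuArchSectionPlaceBlock        -- ★ `placeSec`, `archUFormPi_placeSec_self∕_of_ne`
import Summits.HodgeConjecture.HodgeConjecture.Theorems.K2LiuArchPlaceSecExp              -- ★ the 𝔻-datum letters (`cmGramEntry`, `cmPlaceOver`, …)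
import HarnessLib

/-!
# Crux `HLiu418`, organ S2-J, (J2⊗-arch) FILE 2b part 2: `(placeSec_𝔻 σ h) ⊗ 1 = placeSec_𝕎 σ (relabel (toBig (h, 1)))`

Cell `hodgecm-mathlib`, crux item hLiu418 = `stmt-HodgeConjecture-24832` (helper lane `--supports`, count-neutral).

D10 currency `(L e dV hdV dW hdW eW e′ dV′ hdV′)`; doubled diagonal `t₀^𝔻 = Sum.elim cmGramEntry (−cmGramEntry) ∘ e₂⁻¹`; CM place data
`(cmPlaceOver L, imagUnit L)`; ★ `placeSec` of `𝔻` (frame `(e, dV, dW)`) and of `𝕎 = 𝔻 ⊗ V′` (frame `(e′, dV, tensorFrame dW eW dV′)`).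
`signVec_tensor` (the `hz` of ★ J0∕FILE 1∕FILE 2a, `y k = σ(dV′ k)`); `archUFormPi_injective_cm`; `archUFormPi_tensorEmb_placeSec_self∕_of_ne`
(sign-frame components of `((placeSec_𝔻 σ h) ⊗ 1)_∞`: `relabel eP eQ (toBig (h,1))` at `σ`, `1` elsewhere); **`archPart_tensorEmb_placeSec`** and the
adelic **`tensorEmb_archToAdelic_placeSec`** (J2c's input).  `(eP, eQ)` is ANY frame identification with the `dpEquiv`-compatibility `hE`
(★ FILE 2a `sumCongr_tensorEquiv_compatible` discharges it for ★ J0's equivalences).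
References: [KonnoKonno2007, §3.1 (3.1)]; [Kudla1994, §2]; [HarrisKudlaSweet1996, §1 (1.8)]; [BorelJacquet1979, §4.1].
HONEST LABEL: HC_CM is proved only modulo the 7 printed citations (2 remaining named inputs: hLiu418 = stmt-HodgeConjecture-24832,
h413 = stmt-HodgeConjecture-24833) until rung 0 closes; count-neutral helper, closes no socket.
-/

set_option autoImplicit false
set_option linter.dupNamespace false

noncomputable section

open scoped Matrix Kronecker Classical
open NumberField NumberField.InfinitePlace NumberField.mixedEmbedding IsDedekindDomain

namespace Summit.HodgeConjecture.HodgeConjecture.Cruxes.HLiu418.K2LiuArchTensorPlaceSec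

open Literature.NumberTheory.Automorphic Literature.NumberTheory.Automorphic.UnitaryGroup Literature.NumberTheory.Weil1964
open Literature.NumberTheory.GelbartRogawski1991 Literature.NumberTheory.GelbartRogawski1991.UnitaryDualPair
open Literature.NumberTheory.GelbartRogawski1991.UnitaryDualPair.LocalSplitting
open Literature.NumberTheory.GelbartRogawski1991.GRConstruction Literature.NumberTheory.K2Lit.SiegelDoubled
open Literature.RepresentationTheory.HeisenbergGroup Literature.Analysis.SegalBargmann
open Literature.RepresentationTheory.KonnoKonno2007 Literature.RepresentationTheory.KonnoKonno2007.RealDualPair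
open Summit.HodgeConjecture.HodgeConjecture.Cruxes.HLiu418 Summit.HodgeConjecture.HodgeConjecture.Cruxes.HLiu418.K2LiuArchSectionPlaceBlock

variable (L : Type) [Field L] [NumberField L] [IsCMField L]
variable {N M n : ℕ} (e : Fin N × Fin M ≃ Fin n)
  (dV : Fin N → L) (hdV : ∀ i, IsCMField.complexConj L (dV i) = dV i)
  (dW : Fin M → L) (hdW : ∀ i, IsCMField.complexConj L (dW i) = dW i)
variable {M₂ M' n' : ℕ} (eW : Fin M × Fin M₂ ≃ Fin M') (e' : Fin N × Fin M' ≃ Fin n')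
  (dV' : Fin M₂ → L) (hdV' : ∀ k, IsCMField.complexConj L (dV' k) = dV' k)

/-- **the doubled diagonal of the tensor datum is the Kronecker product**: `t₀^{𝔻⊗V′} (epsD (x, k)) = t₀^𝔻 x · dV′ k` in `L`
(★ `coe_cmGramEntry`, ★ `epsD_inl∕inr`, ★ `epsV_apply`, `tensorFrame`). [cite: Kudla1994, §2 (doubled space, Siegel parabolic)] -/
theorem coe_tensorDiag_epsD (x : Fin (n + n)) (k : Fin M₂) :
    ((Sum.elim (cmGramEntry L e' dV hdV (tensorFrame L dW eW dV') (tensorFrame_real L dW hdW eW dV' hdV'))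
        (-cmGramEntry L e' dV hdV (tensorFrame L dW eW dV') (tensorFrame_real L dW hdW eW dV' hdV'))
        ((e₂ n').symm (epsD e eW e' (x, k))) : ↥(maximalRealSubfield L)) : L) =
      ((Sum.elim (cmGramEntry L e dV hdV dW hdW) (-cmGramEntry L e dV hdV dW hdW) ((e₂ n).symm x) :
          ↥(maximalRealSubfield L)) : L) * dV' k := by
  obtain ⟨s, rfl⟩ := (e₂ n).surjective x
  rcases s with x | x
  · obtain ⟨⟨i, j⟩, rfl⟩ := e.surjective x
    rw [epsD_inl, Equiv.symm_apply_apply, Equiv.symm_apply_apply, Sum.elim_inl, Sum.elim_inl, coe_cmGramEntry, coe_cmGramEntry,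
      epsV_apply, Equiv.symm_apply_apply, Equiv.symm_apply_apply, tensorFrame, Equiv.symm_apply_apply]
    ring
  · obtain ⟨⟨i, j⟩, rfl⟩ := e.surjective x
    rw [epsD_inr, Equiv.symm_apply_apply, Equiv.symm_apply_apply, Sum.elim_inr, Sum.elim_inr, Pi.neg_apply, Pi.neg_apply,
      NegMemClass.coe_neg, NegMemClass.coe_neg, coe_cmGramEntry, coe_cmGramEntry,
      epsV_apply, Equiv.symm_apply_apply, Equiv.symm_apply_apply, tensorFrame, Equiv.symm_apply_apply]
    ring


/-- **the sign vector of the tensor datum at `σ` is the Kronecker product** of the sign vector of `𝔻` with `σ ∘ dV′` — the hypothesis `hz` of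
★ J0-b∕FILE 1∕FILE 2a. [cite: KonnoKonno2007, §3.1] [cite: Kudla1994, §2 (doubled space, Siegel parabolic)] -/
theorem signVec_tensor (σ : {v : InfinitePlace (Fp L) // v.IsReal}) (j : Fin (n' + n')) :
    signVec (cmPlaceOver L)
        (fun k => Sum.elim (cmGramEntry L e' dV hdV (tensorFrame L dW eW dV') (tensorFrame_real L dW hdW eW dV' hdV'))
          (-cmGramEntry L e' dV hdV (tensorFrame L dW eW dV') (tensorFrame_real L dW hdW eW dV' hdV')) ((e₂ n').symm k))
        (imagUnit L) σ j =
      signVec (cmPlaceOver L)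
          (fun k => Sum.elim (cmGramEntry L e dV hdV dW hdW) (-cmGramEntry L e dV hdV dW hdW) ((e₂ n).symm k)) (imagUnit L) σ
          ((epsD e eW e').symm j).1 *
        embedding_of_isReal σ.2
          (⟨dV' ((epsD e eW e').symm j).2, (IsCMField.complexConj_eq_self_iff (K := L) (dV' ((epsD e eW e').symm j).2)).1 (hdV' _)⟩ :
            Fp L) := by
  obtain ⟨⟨x, k⟩, rfl⟩ := (epsD e eW e').surjective j
  rw [Equiv.symm_apply_apply]
  have hF : (Sum.elim (cmGramEntry L e' dV hdV (tensorFrame L dW eW dV') (tensorFrame_real L dW hdW eW dV' hdV'))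
        (-cmGramEntry L e' dV hdV (tensorFrame L dW eW dV') (tensorFrame_real L dW hdW eW dV' hdV')) ((e₂ n').symm (epsD e eW e' (x, k))) :
          Fp L) =
      Sum.elim (cmGramEntry L e dV hdV dW hdW) (-cmGramEntry L e dV hdV dW hdW) ((e₂ n).symm x) *
        (⟨dV' k, (IsCMField.complexConj_eq_self_iff (K := L) (dV' k)).1 (hdV' _)⟩ : Fp L) :=
    Subtype.ext (coe_tensorDiag_epsD L e dV hdV dW hdW eW e' dV' hdV' x k)
  simp only [signVec, placeSignVec, hF, map_mul]
  ring



/-- **THE `σ`-COMPONENT**: in the sign frame at `σ`, `((placeSec_𝔻 σ h) ⊗ 1)_∞` read through `archUFormPi_𝕎` IS `relabel eP eQ (toBig (h, 1))` for every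
frame identification `(eP, eQ)` compatible with the two sign splittings through `dpEquiv` (★ FILE 2a `sumCongr_tensorEquiv_compatible`: ★ J0's is) —
★ `coe_archUForm` + ★ FILE 2b-1 `coe_archAt_archPart_tensorEmb` + ★ FILE 2a `reindex_signSplit_scaleConj_tensor` + ★ `archUFormPi_placeSec_self`
+ ★ `coe_toBig` + ★ `UForm.coe_relabel`. [cite: KonnoKonno2007, §3.1 (3.1)] [cite: Kudla1994, §2 (doubled space, Siegel parabolic)] -/
theorem archUFormPi_tensorEmb_placeSec_self (hdV0 : ∀ i, dV i ≠ 0) (hdW0 : ∀ i, dW i ≠ 0) (hdV'0 : ∀ k, dV' k ≠ 0)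
    (σ : {v : InfinitePlace (Fp L) // v.IsReal})
    (h : UForm (PosIdx (signVec (cmPlaceOver L)
          (fun k => Sum.elim (cmGramEntry L e dV hdV dW hdW) (-cmGramEntry L e dV hdV dW hdW) ((e₂ n).symm k)) (imagUnit L) σ))
        (NegIdx (signVec (cmPlaceOver L)
          (fun k => Sum.elim (cmGramEntry L e dV hdV dW hdW) (-cmGramEntry L e dV hdV dW hdW) ((e₂ n).symm k)) (imagUnit L) σ)))
    (y : Fin M₂ → ℝ) (hy : ∀ k, y k ≠ 0)
    (hz : ∀ j, signVec (cmPlaceOver L)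
        (fun k => Sum.elim (cmGramEntry L e' dV hdV (tensorFrame L dW eW dV') (tensorFrame_real L dW hdW eW dV' hdV'))
          (-cmGramEntry L e' dV hdV (tensorFrame L dW eW dV') (tensorFrame_real L dW hdW eW dV' hdV')) ((e₂ n').symm k))
        (imagUnit L) σ j =
      signVec (cmPlaceOver L)
          (fun k => Sum.elim (cmGramEntry L e dV hdV dW hdW) (-cmGramEntry L e dV hdV dW hdW) ((e₂ n).symm k)) (imagUnit L) σ
          ((epsD e eW e').symm j).1 * y ((epsD e eW e').symm j).2)
    (eP : (PosIdx (signVec (cmPlaceOver L)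
          (fun k => Sum.elim (cmGramEntry L e dV hdV dW hdW) (-cmGramEntry L e dV hdV dW hdW) ((e₂ n).symm k)) (imagUnit L) σ) × PosIdx y) ⊕
        (NegIdx (signVec (cmPlaceOver L)
          (fun k => Sum.elim (cmGramEntry L e dV hdV dW hdW) (-cmGramEntry L e dV hdV dW hdW) ((e₂ n).symm k)) (imagUnit L) σ) × NegIdx y) ≃
      PosIdx (signVec (cmPlaceOver L)
        (fun k => Sum.elim (cmGramEntry L e' dV hdV (tensorFrame L dW eW dV') (tensorFrame_real L dW hdW eW dV' hdV'))
          (-cmGramEntry L e' dV hdV (tensorFrame L dW eW dV') (tensorFrame_real L dW hdW eW dV' hdV')) ((e₂ n').symm k))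
        (imagUnit L) σ))
    (eQ : (PosIdx (signVec (cmPlaceOver L)
          (fun k => Sum.elim (cmGramEntry L e dV hdV dW hdW) (-cmGramEntry L e dV hdV dW hdW) ((e₂ n).symm k)) (imagUnit L) σ) × NegIdx y) ⊕
        (NegIdx (signVec (cmPlaceOver L)
          (fun k => Sum.elim (cmGramEntry L e dV hdV dW hdW) (-cmGramEntry L e dV hdV dW hdW) ((e₂ n).symm k)) (imagUnit L) σ) × PosIdx y) ≃
      NegIdx (signVec (cmPlaceOver L)
        (fun k => Sum.elim (cmGramEntry L e' dV hdV (tensorFrame L dW eW dV') (tensorFrame_real L dW hdW eW dV' hdV'))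
          (-cmGramEntry L e' dV hdV (tensorFrame L dW eW dV') (tensorFrame_real L dW hdW eW dV' hdV')) ((e₂ n').symm k))
        (imagUnit L) σ))
    (hE : ∀ i, (dpEquiv _ _ _ _).symm ((eP.sumCongr eQ).symm i) =
      (signSplit (signVec (cmPlaceOver L)
          (fun k => Sum.elim (cmGramEntry L e dV hdV dW hdW) (-cmGramEntry L e dV hdV dW hdW) ((e₂ n).symm k)) (imagUnit L) σ)
        ((epsD e eW e').symm ((signSplit (signVec (cmPlaceOver L)
          (fun k => Sum.elim (cmGramEntry L e' dV hdV (tensorFrame L dW eW dV') (tensorFrame_real L dW hdW eW dV' hdV'))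
            (-cmGramEntry L e' dV hdV (tensorFrame L dW eW dV') (tensorFrame_real L dW hdW eW dV' hdV')) ((e₂ n').symm k))
          (imagUnit L) σ)).symm i)).1,
       signSplit y ((epsD e eW e').symm ((signSplit (signVec (cmPlaceOver L)
          (fun k => Sum.elim (cmGramEntry L e' dV hdV (tensorFrame L dW eW dV') (tensorFrame_real L dW hdW eW dV' hdV'))
            (-cmGramEntry L e' dV hdV (tensorFrame L dW eW dV') (tensorFrame_real L dW hdW eW dV' hdV')) ((e₂ n').symm k))
          (imagUnit L) σ)).symm i)).2)) :
    archUFormPi L (IsCMField.complexConj L) (n' + n') (IsCMField.complexConj_ne_one L) (cmPlaceOver L) (cmPlaceOver_smul L)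
        (cmPlaceOver_comap L) _
        (gramD_gram_realDiagonal_entry_ne_zero L e' dV hdV (tensorFrame L dW eW dV') (tensorFrame_real L dW hdW eW dV' hdV') hdV0
          (tensorFrame_ne_zero L dW eW dV' hdW0 hdV'0))
        (gramD_eq_diagonal_cm L e' dV hdV (tensorFrame L dW eW dV') (tensorFrame_real L dW hdW eW dV' hdV'))
        (J := hermD L e' dV hdV (tensorFrame L dW eW dV') (tensorFrame_real L dW hdW eW dV' hdV')) rfl
        (complexConj_imagUnit L) (imagUnit_ne_zero L)
        (UnitaryGroup.archPart (Fp L) L (IsCMField.complexConj L) (n' + n')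
          (hermD L e' dV hdV (tensorFrame L dW eW dV') (tensorFrame_real L dW hdW eW dV' hdV'))
          (tensorEmb L e dV hdV dW hdW eW e' dV' hdV'
            (UnitaryGroup.archToAdelic (Fp L) L (IsCMField.complexConj L) (n + n) (hermD L e dV hdV dW hdW)
              (placeSec L (IsCMField.complexConj L) (n + n) (IsCMField.complexConj_ne_one L) (cmPlaceOver L) (cmPlaceOver_smul L) _
                (gramD_gram_realDiagonal_entry_ne_zero L e dV hdV dW hdW hdV0 hdW0) (complexConj_imagUnit L) (imagUnit_ne_zero L) σ
                (cmPlaceOver_comap L) (gramD_eq_diagonal_cm L e dV hdV dW hdW) (J := hermD L e dV hdV dW hdW) rfl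
                (complexConj_smul_infinitePlace L) h)))) σ =
      UForm.relabel _ _ _ _ eP eQ (toBig _ _ (PosIdx y) (NegIdx y) (h, 1)) := by
  apply Subtype.ext
  apply Units.ext
  rw [archUFormPi_apply, coe_archUForm, UnitaryGroup.archPart_archToAdelic,
    K2LiuArchTensorEmbArchComponent.coe_archAt_archPart_tensorEmb, UnitaryGroup.archPart_archToAdelic]
  -- the 𝔻 side: `reindex (signSplit x) (scaleConj (sqrtAbs x) M) = matrix h`
  have hM := congrArg Units.val (congrArg Subtype.val
    (archUFormPi_placeSec_self L (IsCMField.complexConj L) (n + n) (IsCMField.complexConj_ne_one L) (cmPlaceOver L) (cmPlaceOver_smul L) _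
      (gramD_gram_realDiagonal_entry_ne_zero L e dV hdV dW hdW hdV0 hdW0) (complexConj_imagUnit L) (imagUnit_ne_zero L) σ
      (cmPlaceOver_comap L) (gramD_eq_diagonal_cm L e dV hdV dW hdW) (J := hermD L e dV hdV dW hdW) rfl
      (complexConj_smul_infinitePlace L) h))
  rw [archUFormPi_apply, coe_archUForm, UnitaryGroup.archPart_archToAdelic] at hM
  rw [K2LiuArchTensorFrameChase.reindex_signSplit_scaleConj_tensor _ _ (epsD e eW e') _ _ (fun k => Real.sqrt |y k|)
      (fun k => (Real.sqrt_pos.2 (abs_pos.2 (hy k))).ne') _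
      (K2LiuArchTensorPlaceSecMatrix.sqrtAbs_tensor _ _ (epsD e eW e') _ hz) _ _ hE, hM, UForm.coe_relabel, coe_toBig]
  simp

/-- every complex place of the CM field `L` is `cmPlaceOver L v` for the real place `v` of `L⁺` below it (★ `cmPlaceOver_eq_mk`). [folklore] -/
theorem exists_cmPlaceOver_eq (w : {w : InfinitePlace L // w.IsComplex}) : ∃ v, cmPlaceOver L v = w :=
  ⟨⟨w.1.comap (algebraMap (Fp L) L), IsTotallyReal.isReal _⟩,
    Subtype.ext ((cmPlaceOver_eq_mk L _ w.1.embedding (by rw [mk_embedding])).trans (mk_embedding w.1))⟩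

/-- `scaleConj D` is injective for a nonvanishing scaling `D`. [folklore] -/
theorem scaleConj_injective {m : Type*} {D : m → ℝ} (hD : ∀ j, D j ≠ 0) {K K' : Matrix m m ℂ} (h : scaleConj D K = scaleConj D K') :
    K = K' := by
  ext i j
  have hij := congrFun (congrFun h i) j
  rw [scaleConj_apply, scaleConj_apply, mul_assoc, mul_assoc] at hij
  have hi : ((D i : ℝ) : ℂ) ≠ 0 := Complex.ofReal_ne_zero.2 (hD i)
  have hj : (((D j : ℝ) : ℂ))⁻¹ ≠ 0 := inv_ne_zero (Complex.ofReal_ne_zero.2 (hD j))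
  exact mul_right_cancel₀ hj (mul_left_cancel₀ hi hij)

/-- **`archUFormPi` (CM case) IS INJECTIVE**: an element of `U(J)(L ⊗ ℝ)` is determined by its sign-frame components at the real places of `L⁺`
(★ `archPiEquiv` + ★ `coe_archUForm` + `scaleConj_injective`). [cite: BorelJacquet1979, §4.1] -/
theorem archUFormPi_injective_cm {N₀ : ℕ} (t₀ : Fin N₀ → Fp L) (ht0 : ∀ j, t₀ j ≠ 0) {T : Matrix (Fin N₀) (Fin N₀) (Fp L)}
    (hTd : T = Matrix.diagonal t₀) {J : Matrix (Fin N₀) (Fin N₀) L} (hJ : J = T.map (algebraMap (Fp L) L)) :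
    Function.Injective (archUFormPi L (IsCMField.complexConj L) N₀ (IsCMField.complexConj_ne_one L) (cmPlaceOver L) (cmPlaceOver_smul L)
      (cmPlaceOver_comap L) t₀ ht0 hTd hJ (complexConj_imagUnit L) (imagUnit_ne_zero L)) := by
  intro g g' hgg'
  apply (UnitaryGroup.archPiEquiv (Fp L) L (IsCMField.complexConj L) N₀ J (IsCMField.complexConj_ne_one L) (complexConj_smul_infinitePlace L)).injective
  funext w
  obtain ⟨v, rfl⟩ := exists_cmPlaceOver_eq L w
  have hv := congrArg Units.val (congrArg Subtype.val (congrFun hgg' v))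
  rw [archUFormPi_apply, archUFormPi_apply, coe_archUForm, coe_archUForm, UnitaryGroup.archPart_archToAdelic,
    UnitaryGroup.archPart_archToAdelic] at hv
  rw [UnitaryGroup.archPiEquiv_apply, UnitaryGroup.archPiEquiv_apply]
  exact Subtype.ext (Units.ext (scaleConj_injective (sqrtAbs_signVec_ne_zero (IsCMField.complexConj_ne_one L) (cmPlaceOver_smul L)
    (complexConj_imagUnit L) (imagUnit_ne_zero L) ht0 v) ((Matrix.reindex _ _).injective hv)))

/-- `scaleConj D 1 = 1`. [folklore] -/
theorem scaleConj_one' {m : Type*} [DecidableEq m] {D : m → ℝ} (hD : ∀ j, D j ≠ 0) : scaleConj D (1 : Matrix m m ℂ) = 1 := by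
  ext i j
  rw [scaleConj_apply, Matrix.one_apply]
  by_cases h : i = j
  · subst h; rw [if_pos rfl, mul_one, mul_inv_cancel₀ (Complex.ofReal_ne_zero.2 (hD i))]
  · rw [if_neg h, mul_zero, zero_mul]

/-- **OFF THE PLACE `σ`**: for `v ≠ σ`, the `v`-component of `((placeSec_𝔻 σ h) ⊗ 1)_∞` in the sign frame is `1` (★ `archAt_archSingle_of_ne`,
`reindex epsD (1 ⊗ₖ 1) = 1`). [cite: BorelJacquet1979, §4.1] -/
theorem archUFormPi_tensorEmb_placeSec_of_ne (hdV0 : ∀ i, dV i ≠ 0) (hdW0 : ∀ i, dW i ≠ 0) (hdV'0 : ∀ k, dV' k ≠ 0)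
    (σ : {v : InfinitePlace (Fp L) // v.IsReal}) {v : {v : InfinitePlace (Fp L) // v.IsReal}} (hv : v ≠ σ)
    (h : UForm (PosIdx (signVec (cmPlaceOver L)
          (fun k => Sum.elim (cmGramEntry L e dV hdV dW hdW) (-cmGramEntry L e dV hdV dW hdW) ((e₂ n).symm k)) (imagUnit L) σ))
        (NegIdx (signVec (cmPlaceOver L)
          (fun k => Sum.elim (cmGramEntry L e dV hdV dW hdW) (-cmGramEntry L e dV hdV dW hdW) ((e₂ n).symm k)) (imagUnit L) σ))) :
    archUFormPi L (IsCMField.complexConj L) (n' + n') (IsCMField.complexConj_ne_one L) (cmPlaceOver L) (cmPlaceOver_smul L)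
        (cmPlaceOver_comap L) _
        (gramD_gram_realDiagonal_entry_ne_zero L e' dV hdV (tensorFrame L dW eW dV') (tensorFrame_real L dW hdW eW dV' hdV') hdV0
          (tensorFrame_ne_zero L dW eW dV' hdW0 hdV'0))
        (gramD_eq_diagonal_cm L e' dV hdV (tensorFrame L dW eW dV') (tensorFrame_real L dW hdW eW dV' hdV'))
        (J := hermD L e' dV hdV (tensorFrame L dW eW dV') (tensorFrame_real L dW hdW eW dV' hdV')) rfl
        (complexConj_imagUnit L) (imagUnit_ne_zero L)
        (UnitaryGroup.archPart (Fp L) L (IsCMField.complexConj L) (n' + n')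
          (hermD L e' dV hdV (tensorFrame L dW eW dV') (tensorFrame_real L dW hdW eW dV' hdV'))
          (tensorEmb L e dV hdV dW hdW eW e' dV' hdV'
            (UnitaryGroup.archToAdelic (Fp L) L (IsCMField.complexConj L) (n + n) (hermD L e dV hdV dW hdW)
              (placeSec L (IsCMField.complexConj L) (n + n) (IsCMField.complexConj_ne_one L) (cmPlaceOver L) (cmPlaceOver_smul L) _
                (gramD_gram_realDiagonal_entry_ne_zero L e dV hdV dW hdW hdV0 hdW0) (complexConj_imagUnit L) (imagUnit_ne_zero L) σ
                (cmPlaceOver_comap L) (gramD_eq_diagonal_cm L e dV hdV dW hdW) (J := hermD L e dV hdV dW hdW) rfl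
                (complexConj_smul_infinitePlace L) h)))) v = 1 := by
  have hne : cmPlaceOver L v ≠ cmPlaceOver L σ := fun h' => hv (wOf_injective (cmPlaceOver_comap L) h')
  apply Subtype.ext
  apply Units.ext
  rw [archUFormPi_apply, coe_archUForm, UnitaryGroup.archPart_archToAdelic,
    K2LiuArchTensorEmbArchComponent.coe_archAt_archPart_tensorEmb, UnitaryGroup.archPart_archToAdelic, placeSec_apply,
    UnitaryGroup.archAt_archSingle_of_ne (Fp L) L (IsCMField.complexConj L) (n + n) (hermD L e dV hdV dW hdW) (IsCMField.complexConj_ne_one L)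
      (complexConj_smul_infinitePlace L) (cmPlaceOver L σ) hne]
  simp only [OneMemClass.coe_one, Units.val_one, Matrix.one_kronecker_one, Matrix.reindex_apply, Matrix.submatrix_one_equiv,
    scaleConj_one' (sqrtAbs_signVec_ne_zero (IsCMField.complexConj_ne_one L) (cmPlaceOver_smul L) (complexConj_imagUnit L) (imagUnit_ne_zero L)
      (gramD_gram_realDiagonal_entry_ne_zero L e' dV hdV (tensorFrame L dW eW dV') (tensorFrame_real L dW hdW eW dV' hdV') hdV0
        (tensorFrame_ne_zero L dW eW dV' hdW0 hdV'0)) v)]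

/-- **(J2⊗-arch) AT THE ARCHIMEDEAN GROUP**: `((placeSec_𝔻 σ h) ⊗ 1)_∞ = placeSec_𝕎 σ (relabel eP eQ (toBig (h, 1)))` — `K_w ⊗ 1 ⊆ K_𝕎` at the group level,
in Konno–Konno's junction frame. [cite: KonnoKonno2007, §3.1 (3.1)] [cite: Kudla1994, §2 (doubled space, Siegel parabolic)] [cite: HarrisKudlaSweet1996, §1 (1.8)] -/
theorem archPart_tensorEmb_placeSec (hdV0 : ∀ i, dV i ≠ 0) (hdW0 : ∀ i, dW i ≠ 0) (hdV'0 : ∀ k, dV' k ≠ 0)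
    (σ : {v : InfinitePlace (Fp L) // v.IsReal})
    (h : UForm (PosIdx (signVec (cmPlaceOver L)
          (fun k => Sum.elim (cmGramEntry L e dV hdV dW hdW) (-cmGramEntry L e dV hdV dW hdW) ((e₂ n).symm k)) (imagUnit L) σ))
        (NegIdx (signVec (cmPlaceOver L)
          (fun k => Sum.elim (cmGramEntry L e dV hdV dW hdW) (-cmGramEntry L e dV hdV dW hdW) ((e₂ n).symm k)) (imagUnit L) σ)))
    (y : Fin M₂ → ℝ) (hy : ∀ k, y k ≠ 0)
    (hz : ∀ j, signVec (cmPlaceOver L)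
        (fun k => Sum.elim (cmGramEntry L e' dV hdV (tensorFrame L dW eW dV') (tensorFrame_real L dW hdW eW dV' hdV'))
          (-cmGramEntry L e' dV hdV (tensorFrame L dW eW dV') (tensorFrame_real L dW hdW eW dV' hdV')) ((e₂ n').symm k))
        (imagUnit L) σ j =
      signVec (cmPlaceOver L)
          (fun k => Sum.elim (cmGramEntry L e dV hdV dW hdW) (-cmGramEntry L e dV hdV dW hdW) ((e₂ n).symm k)) (imagUnit L) σ
          ((epsD e eW e').symm j).1 * y ((epsD e eW e').symm j).2)
    (eP : (PosIdx (signVec (cmPlaceOver L)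
          (fun k => Sum.elim (cmGramEntry L e dV hdV dW hdW) (-cmGramEntry L e dV hdV dW hdW) ((e₂ n).symm k)) (imagUnit L) σ) × PosIdx y) ⊕
        (NegIdx (signVec (cmPlaceOver L)
          (fun k => Sum.elim (cmGramEntry L e dV hdV dW hdW) (-cmGramEntry L e dV hdV dW hdW) ((e₂ n).symm k)) (imagUnit L) σ) × NegIdx y) ≃
      PosIdx (signVec (cmPlaceOver L)
        (fun k => Sum.elim (cmGramEntry L e' dV hdV (tensorFrame L dW eW dV') (tensorFrame_real L dW hdW eW dV' hdV'))
          (-cmGramEntry L e' dV hdV (tensorFrame L dW eW dV') (tensorFrame_real L dW hdW eW dV' hdV')) ((e₂ n').symm k))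
        (imagUnit L) σ))
    (eQ : (PosIdx (signVec (cmPlaceOver L)
          (fun k => Sum.elim (cmGramEntry L e dV hdV dW hdW) (-cmGramEntry L e dV hdV dW hdW) ((e₂ n).symm k)) (imagUnit L) σ) × NegIdx y) ⊕
        (NegIdx (signVec (cmPlaceOver L)
          (fun k => Sum.elim (cmGramEntry L e dV hdV dW hdW) (-cmGramEntry L e dV hdV dW hdW) ((e₂ n).symm k)) (imagUnit L) σ) × PosIdx y) ≃
      NegIdx (signVec (cmPlaceOver L)
        (fun k => Sum.elim (cmGramEntry L e' dV hdV (tensorFrame L dW eW dV') (tensorFrame_real L dW hdW eW dV' hdV'))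
          (-cmGramEntry L e' dV hdV (tensorFrame L dW eW dV') (tensorFrame_real L dW hdW eW dV' hdV')) ((e₂ n').symm k))
        (imagUnit L) σ))
    (hE : ∀ i, (dpEquiv _ _ _ _).symm ((eP.sumCongr eQ).symm i) =
      (signSplit (signVec (cmPlaceOver L)
          (fun k => Sum.elim (cmGramEntry L e dV hdV dW hdW) (-cmGramEntry L e dV hdV dW hdW) ((e₂ n).symm k)) (imagUnit L) σ)
        ((epsD e eW e').symm ((signSplit (signVec (cmPlaceOver L)
          (fun k => Sum.elim (cmGramEntry L e' dV hdV (tensorFrame L dW eW dV') (tensorFrame_real L dW hdW eW dV' hdV'))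
            (-cmGramEntry L e' dV hdV (tensorFrame L dW eW dV') (tensorFrame_real L dW hdW eW dV' hdV')) ((e₂ n').symm k))
          (imagUnit L) σ)).symm i)).1,
       signSplit y ((epsD e eW e').symm ((signSplit (signVec (cmPlaceOver L)
          (fun k => Sum.elim (cmGramEntry L e' dV hdV (tensorFrame L dW eW dV') (tensorFrame_real L dW hdW eW dV' hdV'))
            (-cmGramEntry L e' dV hdV (tensorFrame L dW eW dV') (tensorFrame_real L dW hdW eW dV' hdV')) ((e₂ n').symm k))
          (imagUnit L) σ)).symm i)).2)) :
    UnitaryGroup.archPart (Fp L) L (IsCMField.complexConj L) (n' + n')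
        (hermD L e' dV hdV (tensorFrame L dW eW dV') (tensorFrame_real L dW hdW eW dV' hdV'))
        (tensorEmb L e dV hdV dW hdW eW e' dV' hdV'
          (UnitaryGroup.archToAdelic (Fp L) L (IsCMField.complexConj L) (n + n) (hermD L e dV hdV dW hdW)
            (placeSec L (IsCMField.complexConj L) (n + n) (IsCMField.complexConj_ne_one L) (cmPlaceOver L) (cmPlaceOver_smul L) _
              (gramD_gram_realDiagonal_entry_ne_zero L e dV hdV dW hdW hdV0 hdW0) (complexConj_imagUnit L) (imagUnit_ne_zero L) σ
              (cmPlaceOver_comap L) (gramD_eq_diagonal_cm L e dV hdV dW hdW) (J := hermD L e dV hdV dW hdW) rfl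
              (complexConj_smul_infinitePlace L) h))) =
      placeSec L (IsCMField.complexConj L) (n' + n') (IsCMField.complexConj_ne_one L) (cmPlaceOver L) (cmPlaceOver_smul L) _
        (gramD_gram_realDiagonal_entry_ne_zero L e' dV hdV (tensorFrame L dW eW dV') (tensorFrame_real L dW hdW eW dV' hdV') hdV0
          (tensorFrame_ne_zero L dW eW dV' hdW0 hdV'0))
        (complexConj_imagUnit L) (imagUnit_ne_zero L) σ (cmPlaceOver_comap L)
        (gramD_eq_diagonal_cm L e' dV hdV (tensorFrame L dW eW dV') (tensorFrame_real L dW hdW eW dV' hdV'))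
        (J := hermD L e' dV hdV (tensorFrame L dW eW dV') (tensorFrame_real L dW hdW eW dV' hdV')) rfl (complexConj_smul_infinitePlace L)
        (UForm.relabel _ _ _ _ eP eQ (toBig _ _ (PosIdx y) (NegIdx y) (h, 1))) := by
  refine archUFormPi_injective_cm L
    (fun k => Sum.elim (cmGramEntry L e' dV hdV (tensorFrame L dW eW dV') (tensorFrame_real L dW hdW eW dV' hdV'))
      (-cmGramEntry L e' dV hdV (tensorFrame L dW eW dV') (tensorFrame_real L dW hdW eW dV' hdV')) ((e₂ n').symm k))
    (gramD_gram_realDiagonal_entry_ne_zero L e' dV hdV (tensorFrame L dW eW dV') (tensorFrame_real L dW hdW eW dV' hdV') hdV0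
      (tensorFrame_ne_zero L dW eW dV' hdW0 hdV'0))
    (gramD_eq_diagonal_cm L e' dV hdV (tensorFrame L dW eW dV') (tensorFrame_real L dW hdW eW dV' hdV')) rfl (funext fun v => ?_)
  by_cases hv : v = σ
  · subst hv
    exact (archUFormPi_tensorEmb_placeSec_self L e dV hdV dW hdW eW e' dV' hdV' hdV0 hdW0 hdV'0 v h y hy hz eP eQ hE).trans
      (archUFormPi_placeSec_self L (IsCMField.complexConj L) (n' + n') (IsCMField.complexConj_ne_one L) (cmPlaceOver L) (cmPlaceOver_smul L) _
        (gramD_gram_realDiagonal_entry_ne_zero L e' dV hdV (tensorFrame L dW eW dV') (tensorFrame_real L dW hdW eW dV' hdV') hdV0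
          (tensorFrame_ne_zero L dW eW dV' hdW0 hdV'0))
        (complexConj_imagUnit L) (imagUnit_ne_zero L) v (cmPlaceOver_comap L)
        (gramD_eq_diagonal_cm L e' dV hdV (tensorFrame L dW eW dV') (tensorFrame_real L dW hdW eW dV' hdV')) rfl
        (complexConj_smul_infinitePlace L) _).symm
  · exact (archUFormPi_tensorEmb_placeSec_of_ne L e dV hdV dW hdW eW e' dV' hdV' hdV0 hdW0 hdV'0 σ hv h).trans
      (archUFormPi_placeSec_of_ne L (IsCMField.complexConj L) (n' + n') (IsCMField.complexConj_ne_one L) (cmPlaceOver L) (cmPlaceOver_smul L) _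
        (gramD_gram_realDiagonal_entry_ne_zero L e' dV hdV (tensorFrame L dW eW dV') (tensorFrame_real L dW hdW eW dV' hdV') hdV0
          (tensorFrame_ne_zero L dW eW dV' hdW0 hdV'0))
        (complexConj_imagUnit L) (imagUnit_ne_zero L) σ (cmPlaceOver_comap L)
        (gramD_eq_diagonal_cm L e' dV hdV (tensorFrame L dW eW dV') (tensorFrame_real L dW hdW eW dV' hdV')) rfl
        (complexConj_smul_infinitePlace L) hv _).symm

/-- **(J2⊗-arch), ADELIC FORM** (K2Liu-p05 (g5)'s J2c target, 13:14:07Z): `tensorEmb (archToAdelic (placeSec_𝔻 σ h)) = archToAdelic (placeSec_𝕎 σ (relabel eP eQ (toBig (h, 1))))`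
(★ `tensorEmb_archToAdelic` + the previous theorem). [cite: Kudla1994, §2 (doubled space, Siegel parabolic)] [cite: HarrisKudlaSweet1996, §1 (1.8)] -/
theorem tensorEmb_archToAdelic_placeSec (hdV0 : ∀ i, dV i ≠ 0) (hdW0 : ∀ i, dW i ≠ 0) (hdV'0 : ∀ k, dV' k ≠ 0)
    (σ : {v : InfinitePlace (Fp L) // v.IsReal})
    (h : UForm (PosIdx (signVec (cmPlaceOver L)
          (fun k => Sum.elim (cmGramEntry L e dV hdV dW hdW) (-cmGramEntry L e dV hdV dW hdW) ((e₂ n).symm k)) (imagUnit L) σ))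
        (NegIdx (signVec (cmPlaceOver L)
          (fun k => Sum.elim (cmGramEntry L e dV hdV dW hdW) (-cmGramEntry L e dV hdV dW hdW) ((e₂ n).symm k)) (imagUnit L) σ)))
    (y : Fin M₂ → ℝ) (hy : ∀ k, y k ≠ 0)
    (hz : ∀ j, signVec (cmPlaceOver L)
        (fun k => Sum.elim (cmGramEntry L e' dV hdV (tensorFrame L dW eW dV') (tensorFrame_real L dW hdW eW dV' hdV'))
          (-cmGramEntry L e' dV hdV (tensorFrame L dW eW dV') (tensorFrame_real L dW hdW eW dV' hdV')) ((e₂ n').symm k))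
        (imagUnit L) σ j =
      signVec (cmPlaceOver L)
          (fun k => Sum.elim (cmGramEntry L e dV hdV dW hdW) (-cmGramEntry L e dV hdV dW hdW) ((e₂ n).symm k)) (imagUnit L) σ
          ((epsD e eW e').symm j).1 * y ((epsD e eW e').symm j).2)
    (eP : (PosIdx (signVec (cmPlaceOver L)
          (fun k => Sum.elim (cmGramEntry L e dV hdV dW hdW) (-cmGramEntry L e dV hdV dW hdW) ((e₂ n).symm k)) (imagUnit L) σ) × PosIdx y) ⊕
        (NegIdx (signVec (cmPlaceOver L)
          (fun k => Sum.elim (cmGramEntry L e dV hdV dW hdW) (-cmGramEntry L e dV hdV dW hdW) ((e₂ n).symm k)) (imagUnit L) σ) × NegIdx y) ≃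
      PosIdx (signVec (cmPlaceOver L)
        (fun k => Sum.elim (cmGramEntry L e' dV hdV (tensorFrame L dW eW dV') (tensorFrame_real L dW hdW eW dV' hdV'))
          (-cmGramEntry L e' dV hdV (tensorFrame L dW eW dV') (tensorFrame_real L dW hdW eW dV' hdV')) ((e₂ n').symm k))
        (imagUnit L) σ))
    (eQ : (PosIdx (signVec (cmPlaceOver L)
          (fun k => Sum.elim (cmGramEntry L e dV hdV dW hdW) (-cmGramEntry L e dV hdV dW hdW) ((e₂ n).symm k)) (imagUnit L) σ) × NegIdx y) ⊕
        (NegIdx (signVec (cmPlaceOver L)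
          (fun k => Sum.elim (cmGramEntry L e dV hdV dW hdW) (-cmGramEntry L e dV hdV dW hdW) ((e₂ n).symm k)) (imagUnit L) σ) × PosIdx y) ≃
      NegIdx (signVec (cmPlaceOver L)
        (fun k => Sum.elim (cmGramEntry L e' dV hdV (tensorFrame L dW eW dV') (tensorFrame_real L dW hdW eW dV' hdV'))
          (-cmGramEntry L e' dV hdV (tensorFrame L dW eW dV') (tensorFrame_real L dW hdW eW dV' hdV')) ((e₂ n').symm k))
        (imagUnit L) σ))
    (hE : ∀ i, (dpEquiv _ _ _ _).symm ((eP.sumCongr eQ).symm i) =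
      (signSplit (signVec (cmPlaceOver L)
          (fun k => Sum.elim (cmGramEntry L e dV hdV dW hdW) (-cmGramEntry L e dV hdV dW hdW) ((e₂ n).symm k)) (imagUnit L) σ)
        ((epsD e eW e').symm ((signSplit (signVec (cmPlaceOver L)
          (fun k => Sum.elim (cmGramEntry L e' dV hdV (tensorFrame L dW eW dV') (tensorFrame_real L dW hdW eW dV' hdV'))
            (-cmGramEntry L e' dV hdV (tensorFrame L dW eW dV') (tensorFrame_real L dW hdW eW dV' hdV')) ((e₂ n').symm k))
          (imagUnit L) σ)).symm i)).1,
       signSplit y ((epsD e eW e').symm ((signSplit (signVec (cmPlaceOver L)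
          (fun k => Sum.elim (cmGramEntry L e' dV hdV (tensorFrame L dW eW dV') (tensorFrame_real L dW hdW eW dV' hdV'))
            (-cmGramEntry L e' dV hdV (tensorFrame L dW eW dV') (tensorFrame_real L dW hdW eW dV' hdV')) ((e₂ n').symm k))
          (imagUnit L) σ)).symm i)).2)) :
    tensorEmb L e dV hdV dW hdW eW e' dV' hdV'
        (UnitaryGroup.archToAdelic (Fp L) L (IsCMField.complexConj L) (n + n) (hermD L e dV hdV dW hdW)
          (placeSec L (IsCMField.complexConj L) (n + n) (IsCMField.complexConj_ne_one L) (cmPlaceOver L) (cmPlaceOver_smul L) _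
            (gramD_gram_realDiagonal_entry_ne_zero L e dV hdV dW hdW hdV0 hdW0) (complexConj_imagUnit L) (imagUnit_ne_zero L) σ
            (cmPlaceOver_comap L) (gramD_eq_diagonal_cm L e dV hdV dW hdW) (J := hermD L e dV hdV dW hdW) rfl
            (complexConj_smul_infinitePlace L) h)) =
      UnitaryGroup.archToAdelic (Fp L) L (IsCMField.complexConj L) (n' + n')
        (hermD L e' dV hdV (tensorFrame L dW eW dV') (tensorFrame_real L dW hdW eW dV' hdV'))
      (placeSec L (IsCMField.complexConj L) (n' + n') (IsCMField.complexConj_ne_one L) (cmPlaceOver L) (cmPlaceOver_smul L) _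
        (gramD_gram_realDiagonal_entry_ne_zero L e' dV hdV (tensorFrame L dW eW dV') (tensorFrame_real L dW hdW eW dV' hdV') hdV0
          (tensorFrame_ne_zero L dW eW dV' hdW0 hdV'0))
        (complexConj_imagUnit L) (imagUnit_ne_zero L) σ (cmPlaceOver_comap L)
        (gramD_eq_diagonal_cm L e' dV hdV (tensorFrame L dW eW dV') (tensorFrame_real L dW hdW eW dV' hdV'))
        (J := hermD L e' dV hdV (tensorFrame L dW eW dV') (tensorFrame_real L dW hdW eW dV' hdV')) rfl (complexConj_smul_infinitePlace L)
        (UForm.relabel _ _ _ _ eP eQ (toBig _ _ (PosIdx y) (NegIdx y) (h, 1)))) := by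
  rw [K2LiuTensorEmbArchFinParts.tensorEmb_archToAdelic, archPart_tensorEmb_placeSec L e dV hdV dW hdW eW e' dV' hdV' hdV0 hdW0 hdV'0 σ h y hy hz eP eQ hE]

end Summit.HodgeConjecture.HodgeConjecture.Cruxes.HLiu418.K2LiuArchTensorPlaceSec

end
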